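import Summits.BirchSwinnertonDyer.BirchSwinnertonDyer.Theorems.ManinLocalTwoThreeShimuraQuotientConjugation
import Literature.NumberTheory.EllipticCurves.ShimuraSubgroupHeckeCongruence
import Literature.NumberTheory.EllipticCurves.PeriodLatticeGamma1QuotientProofs
import Literature.NumberTheory.ModularForms.ModularFormsNebentypusDecomposition
import HarnessLib

/-!
# The Shimura quotient `Λ₀(f)/Λ₁(f)` is EISENSTEIN: `(a_p − p − 1) Λ₀(f) ⊆ Λ₁(f)` for primes `p ∤ N`

Summit `BirchSwinnertonDyer`, route `ManinLocalTwoThree` (cell bsd-f2-manin), cruxes C3 `ManinPrimeToThreeAtNine` (stmt-BirchSwinnertonDyer-22968)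
and C2 `ManinOddAtFour` (stmt-BirchSwinnertonDyer-22967); lead p1 gen 14.  The `p ∤ N` half of Ling–Oesterlé's Theorem 6 («`T_p = p + 1`
on the Shimura subgroup `Σ(N)` for `p ∤ N`», first proved by Ribet) in PERIOD-LATTICE form — the half that
`Literature/…/ShimuraSubgroupHeckeCongruence.lean` left out («NOT here: … the `p ∤ N` half `T_p = p + 1` (they need `Σ(N)` itself)»).
It does NOT need `Σ(N)`: the same modular-symbol mechanism as the `p ∣ N` half works.

MECHANISM (`sub_mul_cuspSymbol_mem_periodLatticeGamma1_of_not_dvd`).  For `γ = (a b; c d) ∈ Γ₀(N)`, `c ≠ 0`, and `T_p f = α f`: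
`α{∞, γ∞}_f = ∑_{j mod p} {∞, (γ∞ + j)/p}_f + {∞, p·γ∞}_f` (`modularSymbol_heckeT_eq_sum`).  Each term is `{∞, δ∞}_f` for a
`δ ∈ Γ₀(N)` (`Gamma0.mkOfCol`), and the class of `{∞, δ∞}_f` in `Λ₀/Λ₁` depends only on `d_δ mod N`
(`cuspSymbol_sub_mem_periodLatticeGamma1_of_apply_eq`).  If `p ∣ c` all `p + 1` matrices have `d_δ ≡ d`; if `p ∤ c`, the `p − 1` columns
`(a + jc, pc)` with `p ∤ a + jc` give `d_δ ≡ d`, the column `((a + j₀c)/p, c)` gives `d_δ ≡ p·d`, and `(pa, c)` gives `d_δ ≡ p⁻¹·d`; with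
`η ∈ Γ₀(N)`, `d_η ≡ p`, these two are the classes of `ηγ` and `η⁻¹γ`, whose periods sum to `2{∞, γ∞}` (Manin's homomorphism).  Either way
`α{∞, γ∞} ≡ (p + 1){∞, γ∞} (mod Λ₁(f))`.

* `sub_mul_cuspSymbol_mem_periodLatticeGamma1_of_not_dvd`, **`heckeEigenPeriodCongruence_of_not_dvd`** — `(α − p − 1) Λ₀(f) ⊆ Λ₁(f)` for
  `T_p f = α f`, `p ∤ N` prime (any `f ∈ S₂(Γ₀(N))`);
* **`dvd_cuspCoeff_sub_of_periodLatticeGamma1_ne`** — for a newform whose Shimura quotient is killed by a prime `q` (`qΛ₀ ⊆ Λ₁`, e.g. `q` a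
  traceless prime with `q² ∣ N`) and is NON-TRIVIAL (`Λ₁ ≠ Λ₀`): **`q ∣ a_p − p − 1` for every prime `p ∤ N`** — `f` is EISENSTEIN mod `q`;
* **`three_dvd_lFunction_sub_of_periodLatticeGamma1_ne`** (C3 side, `9 ∣ N`) / **`two_dvd_lFunction_sub_of_periodLatticeGamma1_ne`** (C2 side,
  `4 ∣ N`): for a lattice-optimal `X₀(N)`-datum of `W₀` with `Λ₁(f) ≠ Λ₀(f)`: `3 ∣ a_p(W₀) − p − 1` (resp. `2 ∣ a_p(W₀) − p − 1`) for every
  prime `p ∤ N`.  So the Γ₀/Γ₁ transfer can fail (and a Manin defect at `3`, resp. `2`, can occur) ONLY on optimal curves that are Eisenstein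
  mod `3` (resp. `2`) — a sharp, census-ready restriction complementing the tree's trichotomies (rational `Ψ₃`-root / rational `2`-torsion).

HONEST FRAMING: unconditional theorems; they do NOT prove Manin's conjecture, C2, C3 or BSD (all OPEN).  No definitions, no named facts,
no sorry. [cite: LingOesterle1991, Thm. 6 (p. 176), «T_p = p + 1 on Σ(N) for p ∤ N» (Ribet); period-lattice form proved here]
[cite: CremonaAlgorithms1997, §2.4 (2.4.1)–(2.4.2)] [cite: Stevens1989, §2]
-/

set_option autoImplicit false
-- the summit-side namespace `Summit.BirchSwinnertonDyer.BirchSwinnertonDyer.…` is the tree's (summit = sub-problem)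
set_option linter.dupNamespace false

noncomputable section

open scoped Classical MatrixGroups ModularForm
open WeierstrassCurve Literature.NumberTheory.EllipticCurves Literature.NumberTheory.EllipticCurves.ModularForms
open CongruenceSubgroup

namespace Summit.BirchSwinnertonDyer.BirchSwinnertonDyer.Theorems.ManinLocalTwoThree

variable {N : ℕ}

/-! ## §1 Matrix bookkeeping in `Γ₀(N)` -/

/-- **Same class in `Γ₀(N)/Γ₁(N)` from one congruence**: if `a_γ · d_δ ≡ 1 (mod N)` then `d_γ ≡ d_δ (mod N)` (both are `a_γ⁻¹`). [folklore] -/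
theorem gamma0_apply_one_one_eq_of_mul_eq_one_mod_level (γ δ : Gamma0 N)
    (h : (((γ : SL(2, ℤ)) 0 0 : ℤ) : ZMod N) * (((δ : SL(2, ℤ)) 1 1 : ℤ) : ZMod N) = 1) :
    (((γ : SL(2, ℤ)) 1 1 : ℤ) : ZMod N) = (((δ : SL(2, ℤ)) 1 1 : ℤ) : ZMod N) := by
  have h1 := Literature.NumberTheory.ModularForms.det_mod_of_mem_Gamma0 γ
  calc (((γ : SL(2, ℤ)) 1 1 : ℤ) : ZMod N)
      = (((γ : SL(2, ℤ)) 1 1 : ℤ) : ZMod N) * ((((γ : SL(2, ℤ)) 0 0 : ℤ) : ZMod N) * (((δ : SL(2, ℤ)) 1 1 : ℤ) : ZMod N)) := by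
        rw [h, mul_one]
    _ = ((((γ : SL(2, ℤ)) 0 0 : ℤ) : ZMod N) * (((γ : SL(2, ℤ)) 1 1 : ℤ) : ZMod N)) * (((δ : SL(2, ℤ)) 1 1 : ℤ) : ZMod N) := by ring
    _ = _ := by rw [h1, one_mul]

/-- `u · d_δ ≡ 1 (mod N)` for `δ = Gamma0.mkOfCol u v` (determinant read mod `N ∣ v`). [folklore] -/
theorem mkOfCol_mul_apply_one_one (u v : ℤ) (huv : IsCoprime u v) (hv : (N : ℤ) ∣ v) :
    ((u : ℤ) : ZMod N) * ((((Gamma0.mkOfCol u v huv hv : Gamma0 N) : SL(2, ℤ)) 1 1 : ℤ) : ZMod N) = 1 := by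
  have h := Literature.NumberTheory.ModularForms.det_mod_of_mem_Gamma0 (Gamma0.mkOfCol u v huv hv : Gamma0 N)
  rwa [Gamma0.mkOfCol_apply_zero_zero] at h

variable [NeZero N] (f : CuspForm (Gamma0 N) 2)

/-- `{∞, δ∞}_f − {∞, γ∞}_f ∈ Λ₁(f)` as soon as `a_γ · d_δ ≡ 1 (mod N)`. [cite: Stevens1989, §2] -/
theorem cuspSymbol_sub_mem_periodLatticeGamma1_of_mul_eq_one (γ δ : Gamma0 N)
    (h : (((γ : SL(2, ℤ)) 0 0 : ℤ) : ZMod N) * (((δ : SL(2, ℤ)) 1 1 : ℤ) : ZMod N) = 1) :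
    cuspSymbol f δ - cuspSymbol f γ ∈ periodLatticeGamma1 f :=
  cuspSymbol_sub_mem_periodLatticeGamma1_of_apply_eq f γ δ (gamma0_apply_one_one_eq_of_mul_eq_one_mod_level γ δ h)

/-- `{∞, g⁻¹∞}_f = −{∞, g∞}_f` (Manin's homomorphism). [cite: Manin1972, Prop. 1.4 / Thm. 1.6] -/
theorem cuspSymbol_inv (g : Gamma0 N) : cuspSymbol f g⁻¹ = -cuspSymbol f g := by
  have h := cuspSymbol_mul_holds f g g⁻¹
  rw [mul_inv_cancel, cuspSymbol_one] at h
  linear_combination -h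

/-! ## §2 `(α − p − 1){∞, γ∞}_f ∈ Λ₁(f)` for `T_p f = α f`, `p ∤ N` -/

/-- **Ling–Oesterlé / Ribet, `p ∤ N`, on generators**: `(α − p − 1)·{∞, γ∞}_f ∈ Λ₁(f)` for `T_p f = α f`, `p ∤ N` prime, `γ ∈ Γ₀(N)`.
[cite: LingOesterle1991, Thm. 6 («T_p = p + 1 on Σ(N), p ∤ N»); period-lattice form proved here] [cite: CremonaAlgorithms1997, §2.4] -/
theorem sub_mul_cuspSymbol_mem_periodLatticeGamma1_of_not_dvd {p : ℕ} [NeZero p] (hp : p.Prime) (hpN : ¬ p ∣ N)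
    {α : ℂ} (hT : heckeT (Gamma0 N) 2 p f = α • f) (γ : Gamma0 N) :
    (α - (p + 1)) * cuspSymbol f γ ∈ periodLatticeGamma1 f := by
  set a : ℤ := (γ : SL(2, ℤ)) 0 0 with ha_def
  set c : ℤ := (γ : SL(2, ℤ)) 1 0 with hc_def
  by_cases hc : c = 0
  · have : cuspSymbol f γ = 0 := by rw [cuspSymbol, ← hc_def, if_pos hc]
    rw [this, mul_zero]; exact zero_mem _
  have hac : IsCoprime a c := Matrix.SpecialLinearGroup.isCoprime_col (γ : SL(2, ℤ)) 0
  have hNc : (N : ℤ) ∣ c := dvd_entry_of_mem_Gamma0 N γ.2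
  have hpP : Prime (p : ℤ) := Nat.prime_iff_prime_int.mp hp
  have hp0 : (p : ℚ) ≠ 0 := by exact_mod_cast hp.ne_zero
  have hp0Z : (p : ℤ) ≠ 0 := by exact_mod_cast hp.ne_zero
  have hc' : (c : ℚ) ≠ 0 := by exact_mod_cast hc
  have haN : ((a : ℤ) : ZMod N) * (((γ : SL(2, ℤ)) 1 1 : ℤ) : ZMod N) = 1 := Literature.NumberTheory.ModularForms.det_mod_of_mem_Gamma0 γ
  have hcN : ((c : ℤ) : ZMod N) = 0 := (ZMod.intCast_zmod_eq_zero_iff_dvd c N).mpr hNc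
  -- the Hecke sum
  have hTa : α * cuspSymbol f γ = ∑ j : Fin p, modularSymbol f ((((a : ℚ) / c) + ((j : ℕ) : ℤ)) / p) +
      modularSymbol f (p * ((a : ℚ) / c)) := by
    rw [← cuspSymbol_smul, ← hT, cuspSymbol, ← hc_def, if_neg hc, modularSymbol_heckeT_eq_sum p f hp, if_neg hpN, ← ha_def]
  -- columns `(a + jc, pc)` with `p ∤ a + jc`: class `d`
  have hgen : ∀ j : ℤ, ¬ (p : ℤ) ∣ a + j * c →
      modularSymbol f ((((a : ℚ) / c) + (j : ℚ)) / p) - cuspSymbol f γ ∈ periodLatticeGamma1 f := by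
    intro j hndvd
    have hajc : IsCoprime (a + j * c) c := by simpa [mul_comm] using hac.add_mul_right_left j
    have hpc : IsCoprime (a + j * c) (p * c) := ((hpP.coprime_iff_not_dvd.mpr hndvd).symm).mul_right hajc
    set δ : Gamma0 N := Gamma0.mkOfCol (a + j * c) (p * c) hpc (hNc.mul_left _) with hδ
    have hδsym : cuspSymbol f δ = modularSymbol f ((((a : ℚ) / c) + (j : ℚ)) / p) := by
      have hδc : (δ : SL(2, ℤ)) 1 0 ≠ 0 := by
        rw [hδ, Gamma0.mkOfCol_apply_one_zero]; exact mul_ne_zero hp0Z hc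
      rw [cuspSymbol, if_neg hδc, hδ, Gamma0.mkOfCol_apply_zero_zero, Gamma0.mkOfCol_apply_one_zero]
      congr 1; push_cast; field_simp
    rw [← hδsym]
    refine cuspSymbol_sub_mem_periodLatticeGamma1_of_mul_eq_one f γ δ ?_
    have h1 := mkOfCol_mul_apply_one_one (N := N) (a + j * c) (p * c) hpc (hNc.mul_left _)
    rw [← hδ] at h1
    have : (((a + j * c : ℤ)) : ZMod N) = ((a : ℤ) : ZMod N) := by push_cast; rw [hcN]; ring
    rwa [this] at h1
  by_cases hpc : (p : ℤ) ∣ c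
  · -- CASE `p ∣ c`: every term has class `d`
    have hpa : ¬ (p : ℤ) ∣ a := by
      intro h
      obtain ⟨x, y, hxy⟩ := hac
      have h1 : (p : ℤ) ∣ x * a + y * c := dvd_add (h.mul_left x) (hpc.mul_left y)
      rw [hxy] at h1
      exact hpP.not_dvd_one h1
    have hj : ∀ j : ℤ, ¬ (p : ℤ) ∣ a + j * c := fun j h ↦ hpa (by simpa using dvd_sub h (hpc.mul_left j))
    obtain ⟨c', hc'⟩ := hpc
    have hc'0 : c' ≠ 0 := by rintro rfl; exact hc (by rw [hc', mul_zero])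
    have hac' : IsCoprime a c' := by rw [hc'] at hac; exact hac.of_mul_right_right
    have hNc' : (N : ℤ) ∣ c' := by
      have hcop : IsCoprime (N : ℤ) (p : ℤ) := by
        rw [Int.isCoprime_iff_gcd_eq_one]
        have : Nat.Coprime N p := (Nat.Coprime.symm ((Nat.Prime.coprime_iff_not_dvd hp).mpr hpN))
        exact_mod_cast this
      exact hcop.dvd_of_dvd_mul_left (hc' ▸ hNc)
    set δ' : Gamma0 N := Gamma0.mkOfCol a c' hac' hNc' with hδ'
    have hδ'sym : cuspSymbol f δ' = modularSymbol f (p * ((a : ℚ) / c)) := by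
      have hδc : (δ' : SL(2, ℤ)) 1 0 ≠ 0 := by rw [hδ', Gamma0.mkOfCol_apply_one_zero]; exact hc'0
      rw [cuspSymbol, if_neg hδc, hδ', Gamma0.mkOfCol_apply_zero_zero, Gamma0.mkOfCol_apply_one_zero, hc']
      have hc'q : (c' : ℚ) ≠ 0 := by exact_mod_cast hc'0
      congr 1; push_cast; field_simp
    have hlast : modularSymbol f (p * ((a : ℚ) / c)) - cuspSymbol f γ ∈ periodLatticeGamma1 f := by
      rw [← hδ'sym]
      refine cuspSymbol_sub_mem_periodLatticeGamma1_of_mul_eq_one f γ δ' ?_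
      have h1 := mkOfCol_mul_apply_one_one (N := N) a c' hac' hNc'
      rwa [← hδ'] at h1
    have hkey : (α - (p + 1)) * cuspSymbol f γ =
        ∑ j : Fin p, (modularSymbol f ((((a : ℚ) / c) + ((j : ℕ) : ℤ)) / p) - cuspSymbol f γ) +
          (modularSymbol f (p * ((a : ℚ) / c)) - cuspSymbol f γ) := by
      rw [sub_mul, hTa, Finset.sum_sub_distrib, Finset.sum_const, Finset.card_univ, Fintype.card_fin, nsmul_eq_mul]
      ring
    rw [hkey]
    refine add_mem (sum_mem fun j _ ↦ ?_) hlast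
    have := hgen ((j : ℕ) : ℤ) (hj _)
    push_cast at this ⊢
    exact this
  · -- CASE `p ∤ c`: one special index `j₀` with `p ∣ a + j₀ c`
    haveI : Fact p.Prime := ⟨hp⟩
    have hcp : ((c : ℤ) : ZMod p) ≠ 0 := fun h ↦ hpc ((ZMod.intCast_zmod_eq_zero_iff_dvd c p).mp h)
    set j₀z : ZMod p := -((a : ℤ) : ZMod p) * ((c : ℤ) : ZMod p)⁻¹ with hj₀z
    set j₀ : Fin p := ⟨j₀z.val, j₀z.val_lt⟩ with hj₀
    have hj₀cast : ((j₀ : ℕ) : ZMod p) = j₀z := by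
      rw [hj₀]; exact ZMod.natCast_zmod_val j₀z
    have hdvd₀ : (p : ℤ) ∣ a + ((j₀ : ℕ) : ℤ) * c := by
      refine (ZMod.intCast_zmod_eq_zero_iff_dvd _ p).mp ?_
      push_cast; rw [hj₀cast, hj₀z]
      field_simp; ring
    have hother : ∀ j : Fin p, j ≠ j₀ → ¬ (p : ℤ) ∣ a + ((j : ℕ) : ℤ) * c := by
      intro j hj h
      have h1 : (((a + ((j : ℕ) : ℤ) * c : ℤ)) : ZMod p) = 0 := (ZMod.intCast_zmod_eq_zero_iff_dvd _ p).mpr h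
      have h2 : (((a + ((j₀ : ℕ) : ℤ) * c : ℤ)) : ZMod p) = 0 := (ZMod.intCast_zmod_eq_zero_iff_dvd _ p).mpr hdvd₀
      push_cast at h1 h2
      have h3 : ((j : ℕ) : ZMod p) * ((c : ℤ) : ZMod p) = ((j₀ : ℕ) : ZMod p) * ((c : ℤ) : ZMod p) := by
        linear_combination h1 - h2
      have h5 : ((j : ℕ) : ZMod p) = ((j₀ : ℕ) : ZMod p) := mul_right_cancel₀ hcp h3
      apply hj
      apply Fin.ext
      have h6 := congrArg ZMod.val h5
      rwa [ZMod.val_natCast, ZMod.val_natCast, Nat.mod_eq_of_lt j.isLt, Nat.mod_eq_of_lt j₀.isLt] at h6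
    -- `g ∈ Γ₀(N)` with `d_g ≡ p`
    have hpunit : IsUnit ((p : ℕ) : ZMod N) := by
      rw [ZMod.isUnit_iff_coprime]
      exact (Nat.Prime.coprime_iff_not_dvd hp).mpr hpN
    obtain ⟨g, hg⟩ := exists_gamma0_apply_one_one_eq_of_isUnit (N := N) hpunit
    have hginv : (((g : SL(2, ℤ)) 0 0 : ℤ) : ZMod N) * (p : ZMod N) = 1 := by
      have h := Literature.NumberTheory.ModularForms.det_mod_of_mem_Gamma0 g
      rwa [hg] at h
    -- the special column `((a + j₀c)/p, c)`: class of `gγ`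
    obtain ⟨a', ha'⟩ := hdvd₀
    have hac₀ : IsCoprime (a + ((j₀ : ℕ) : ℤ) * c) c := by simpa [mul_comm] using hac.add_mul_right_left ((j₀ : ℕ) : ℤ)
    have ha'c : IsCoprime a' c := by rw [ha'] at hac₀; exact hac₀.of_mul_left_right
    set δ₀ : Gamma0 N := Gamma0.mkOfCol a' c ha'c hNc with hδ₀
    have hδ₀sym : cuspSymbol f δ₀ = modularSymbol f ((((a : ℚ) / c) + (((j₀ : ℕ) : ℤ) : ℚ)) / p) := by
      have hδc : (δ₀ : SL(2, ℤ)) 1 0 ≠ 0 := by rw [hδ₀, Gamma0.mkOfCol_apply_one_zero]; exact hc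
      rw [cuspSymbol, if_neg hδc, hδ₀, Gamma0.mkOfCol_apply_zero_zero, Gamma0.mkOfCol_apply_one_zero]
      have ha'q : ((a : ℚ) + ((j₀ : ℕ) : ℚ) * c) = (p : ℚ) * a' := by exact_mod_cast ha'
      symm
      congr 1
      rw [div_eq_div_iff hp0 hc']
      have e1 : ((a : ℚ) / c + (((j₀ : ℕ) : ℤ) : ℚ)) * c = a + ((j₀ : ℕ) : ℚ) * c := by push_cast; field_simp
      rw [e1, ha'q]; ring
    have hδ₀mem : cuspSymbol f δ₀ - cuspSymbol f (g * γ) ∈ periodLatticeGamma1 f := by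
      refine cuspSymbol_sub_mem_periodLatticeGamma1_of_mul_eq_one f (g * γ) δ₀ ?_
      have h1 := mkOfCol_mul_apply_one_one (N := N) a' c ha'c hNc
      rw [← hδ₀] at h1
      -- `(gγ)₀₀ ≡ g₀₀ a`, and `g₀₀ a d_δ₀ = g₀₀ (p a') d_δ₀ = g₀₀ p = 1`
      have hmul : (((g * γ : Gamma0 N) : SL(2, ℤ)) 0 0 : ℤ) = (g : SL(2, ℤ)) 0 0 * a + (g : SL(2, ℤ)) 0 1 * c := by
        simp [Matrix.mul_apply, Fin.sum_univ_two, ha_def, hc_def]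
      have haa' : ((a : ℤ) : ZMod N) = (p : ZMod N) * ((a' : ℤ) : ZMod N) := by
        have := congrArg (fun z : ℤ ↦ (z : ZMod N)) ha'
        push_cast at this; rw [hcN, mul_zero, add_zero] at this; exact this
      rw [hmul]; push_cast; rw [hcN, mul_zero, add_zero, haa']
      calc (((g : SL(2, ℤ)) 0 0 : ℤ) : ZMod N) * ((p : ZMod N) * ((a' : ℤ) : ZMod N)) * ((((δ₀ : SL(2, ℤ)) 1 1 : ℤ)) : ZMod N)
          = ((((g : SL(2, ℤ)) 0 0 : ℤ) : ZMod N) * (p : ZMod N)) * (((a' : ℤ) : ZMod N) * ((((δ₀ : SL(2, ℤ)) 1 1 : ℤ)) : ZMod N)) := by ring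
        _ = 1 := by rw [hginv, h1, one_mul]
    -- the last column `(pa, c)`: class of `g⁻¹γ`
    have hpa : IsCoprime ((p : ℤ) * a) c := (hpP.coprime_iff_not_dvd.mpr hpc).mul_left hac
    set δ₁ : Gamma0 N := Gamma0.mkOfCol ((p : ℤ) * a) c hpa hNc with hδ₁
    have hδ₁sym : cuspSymbol f δ₁ = modularSymbol f (p * ((a : ℚ) / c)) := by
      have hδc : (δ₁ : SL(2, ℤ)) 1 0 ≠ 0 := by rw [hδ₁, Gamma0.mkOfCol_apply_one_zero]; exact hc
      rw [cuspSymbol, if_neg hδc, hδ₁, Gamma0.mkOfCol_apply_zero_zero, Gamma0.mkOfCol_apply_one_zero]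
      congr 1; push_cast; field_simp
    have hδ₁mem : cuspSymbol f δ₁ - cuspSymbol f (g⁻¹ * γ) ∈ periodLatticeGamma1 f := by
      refine cuspSymbol_sub_mem_periodLatticeGamma1_of_mul_eq_one f (g⁻¹ * γ) δ₁ ?_
      have h1 := mkOfCol_mul_apply_one_one (N := N) ((p : ℤ) * a) c hpa hNc
      rw [← hδ₁] at h1
      have hmul : (((g⁻¹ * γ : Gamma0 N) : SL(2, ℤ)) 0 0 : ℤ) = (g : SL(2, ℤ)) 1 1 * a + (-(g : SL(2, ℤ)) 0 1) * c := by
        have hinv : ((g⁻¹ : Gamma0 N) : SL(2, ℤ)) = (g : SL(2, ℤ))⁻¹ := rfl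
        simp [Matrix.mul_apply, Fin.sum_univ_two, ha_def, hc_def, hinv, Matrix.SpecialLinearGroup.SL2_inv_expl]
      rw [hmul]; push_cast; rw [hcN, mul_zero, add_zero, hg]
      calc (p : ZMod N) * ((a : ℤ) : ZMod N) * ((((δ₁ : SL(2, ℤ)) 1 1 : ℤ)) : ZMod N)
          = ((p : ZMod N) * ((a : ℤ) : ZMod N)) * ((((δ₁ : SL(2, ℤ)) 1 1 : ℤ)) : ZMod N) := by ring
        _ = 1 := by push_cast at h1; exact h1
    -- `{∞, gγ∞} + {∞, g⁻¹γ∞} = 2{∞, γ∞}`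
    have hsum2 : cuspSymbol f (g * γ) + cuspSymbol f (g⁻¹ * γ) = 2 * cuspSymbol f γ := by
      rw [cuspSymbol_mul_holds f g γ, cuspSymbol_mul_holds f g⁻¹ γ, cuspSymbol_inv]; ring
    -- assemble
    set X : Fin p → ℂ := fun j ↦ modularSymbol f ((((a : ℚ) / c) + ((j : ℕ) : ℤ)) / p) - cuspSymbol f γ with hX
    set X₁ : ℂ := modularSymbol f (p * ((a : ℚ) / c)) - cuspSymbol f γ with hX₁
    have hkey : (α - (p + 1)) * cuspSymbol f γ = ∑ j : Fin p, X j + X₁ := by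
      rw [sub_mul, hTa, hX, hX₁, Finset.sum_sub_distrib, Finset.sum_const, Finset.card_univ, Fintype.card_fin, nsmul_eq_mul]
      ring
    rw [hkey, ← Finset.sum_erase_add _ _ (Finset.mem_univ j₀), add_assoc]
    refine add_mem (sum_mem fun j hj ↦ ?_) ?_
    · have hne : j ≠ j₀ := (Finset.mem_erase.mp hj).1
      have := hgen ((j : ℕ) : ℤ) (hother j hne)
      rw [hX]; push_cast at this ⊢; exact this
    · have hdecomp : X j₀ + X₁ = (cuspSymbol f δ₀ - cuspSymbol f (g * γ)) + (cuspSymbol f δ₁ - cuspSymbol f (g⁻¹ * γ)) := by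
        rw [hX, hX₁]; simp only
        rw [hδ₀sym, hδ₁sym]; push_cast
        linear_combination hsum2
      rw [hdecomp]
      exact add_mem hδ₀mem hδ₁mem

/-- **`(α − p − 1) Λ₀(f) ⊆ Λ₁(f)`** for `T_p f = α f`, `p ∤ N` prime — the `p ∤ N` half of Ling–Oesterlé's Theorem 6 in period-lattice
form (the Shimura quotient `Λ₀/Λ₁` is Eisenstein).  Unconditional, for every `f ∈ S₂(Γ₀(N))`.
[cite: LingOesterle1991, Thm. 6 («T_p = p + 1 on Σ(N), p ∤ N», Ribet); period-lattice form proved here] -/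
theorem heckeEigenPeriodCongruence_of_not_dvd {p : ℕ} [NeZero p] (hp : p.Prime) (hpN : ¬ p ∣ N)
    {α : ℂ} (hT : heckeT (Gamma0 N) 2 p f = α • f) {z : ℂ} (hz : z ∈ periodLattice f) :
    (α - (p + 1)) * z ∈ periodLatticeGamma1 f := by
  induction hz using AddSubgroup.closure_induction with
  | mem x hx =>
    obtain ⟨γ, rfl⟩ := hx
    exact sub_mul_cuspSymbol_mem_periodLatticeGamma1_of_not_dvd f hp hpN hT γ
  | zero => rw [mul_zero]; exact zero_mem _
  | add x y _ _ hx hy => rw [mul_add]; exact add_mem hx hy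
  | neg x _ hx => rw [mul_neg]; exact neg_mem hx

/-! ## §3 A non-trivial `q`-torsion Shimura quotient makes `f` Eisenstein mod `q` -/

/-- **Eisenstein congruence.**  If `qΛ₀(f) ⊆ Λ₁(f) ≠ Λ₀(f)` for a prime `q` and `T_p f = a_p f` with `a_p ∈ ℤ` for a prime `p ∤ N`, then
`q ∣ a_p − p − 1`: otherwise `gcd(a_p − p − 1, q) = 1` and Bézout would give `Λ₀ ⊆ Λ₁`.  Unconditional. [cite: LingOesterle1991, Thm. 6] -/
theorem dvd_sub_of_periodLatticeGamma1_ne {q : ℕ} (hq : q.Prime)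
    (hqΛ : ∀ z ∈ periodLattice f, (q : ℂ) * z ∈ periodLatticeGamma1 f)
    (hne : periodLatticeGamma1 f ≠ periodLattice f)
    {p : ℕ} [NeZero p] (hp : p.Prime) (hpN : ¬ p ∣ N) {m : ℤ} (hT : heckeT (Gamma0 N) 2 p f = (m : ℂ) • f) :
    (q : ℤ) ∣ m - p - 1 := by
  by_contra hnd
  have hcop : IsCoprime (m - p - 1) (q : ℤ) :=
    ((Nat.prime_iff_prime_int.mp hq).coprime_iff_not_dvd.mpr hnd).symm
  obtain ⟨x, y, hxy⟩ := hcop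
  apply hne
  refine le_antisymm (periodLatticeGamma1_le_periodLattice f) fun z hz ↦ ?_
  have h1 : ((m : ℂ) - (p + 1)) * z ∈ periodLatticeGamma1 f := heckeEigenPeriodCongruence_of_not_dvd f hp hpN hT hz
  have h2 : (q : ℂ) * z ∈ periodLatticeGamma1 f := hqΛ z hz
  have h1' : (x : ℂ) * (((m : ℂ) - (p + 1)) * z) ∈ periodLatticeGamma1 f := by
    rw [← zsmul_eq_mul]; exact AddSubgroup.zsmul_mem _ h1 x
  have h2' : (y : ℂ) * ((q : ℂ) * z) ∈ periodLatticeGamma1 f := by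
    rw [← zsmul_eq_mul]; exact AddSubgroup.zsmul_mem _ h2 y
  have : z = (x : ℂ) * (((m : ℂ) - (p + 1)) * z) + (y : ℂ) * ((q : ℂ) * z) := by
    have h := congrArg (fun t : ℤ ↦ (t : ℂ)) hxy
    push_cast at h
    linear_combination -z * h
  rw [this]; exact add_mem h1' h2'

/-! ## §4 Application to lattice-optimal `X₀(N)`-data: C3 (`9 ∣ N`) and C2 (`4 ∣ N`) -/

section Data

variable {W₀ : WeierstrassCurve ℚ} (D₀ : ModularParametrizationData W₀ N)

/-- `T_p f = a_p(W₀) • f` for the newform of `W₀` (`a_p(W₀) = W₀.LFunction p ∈ ℤ`). [folklore] -/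
theorem heckeT_eq_lFunction_smul {p : ℕ} [NeZero p] (hp : p.Prime) :
    heckeT (Gamma0 N) 2 p D₀.f = ((W₀.LFunction p : ℤ) : ℂ) • D₀.f := by
  rw [D₀.isNewformOf.1.heckeT_eq_coeff_smul hp]
  change cuspCoeff D₀.f p • D₀.f = _
  rw [D₀.isNewformOf.2 p]

/-- **C3 side: at `9 ∣ N`, `Λ₁(f) ≠ Λ₀(f)` forces `W₀` to be EISENSTEIN mod `3`** — `3 ∣ a_p(W₀) − p − 1` for every prime `p ∤ N`.
(`3Λ₀ ⊆ Λ₁` by the traceless prime `3`, `pMulLatticeLeGamma1OfTracelessPrime_holds`.)  So the Γ₀/Γ₁ transfer at `3` — and with it any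
Manin defect `3 ∣ c₀/c₁` — can only fail on optimal curves with `a_p ≡ p + 1 (mod 3)` for all good `p`.  Unconditional; does not prove C3.
[cite: LingOesterle1991, Thm. 6] [cite: Stevens1989, §2] -/
theorem three_dvd_lFunction_sub_of_periodLatticeGamma1_ne (h9 : 3 ^ 2 ∣ N)
    (hne : periodLatticeGamma1 D₀.f ≠ periodLattice D₀.f) {p : ℕ} (hp : p.Prime) (hpN : ¬ p ∣ N) :
    (3 : ℤ) ∣ W₀.LFunction p - p - 1 := by
  haveI : NeZero p := ⟨hp.ne_zero⟩
  have h3Λ : ∀ v ∈ periodLattice D₀.f, ((3 : ℕ) : ℂ) * v ∈ periodLatticeGamma1 D₀.f := fun v hv ↦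
    pMulLatticeLeGamma1OfTracelessPrime_holds N D₀.f D₀.isNewformOf.1 3 Nat.prime_three
      ((dvd_pow_self 3 two_ne_zero).trans h9) (D₀.isNewformOf.1.cuspCoeff_eq_zero_of_sq_dvd Nat.prime_three h9) v hv
  exact_mod_cast dvd_sub_of_periodLatticeGamma1_ne D₀.f Nat.prime_three h3Λ hne hp hpN (heckeT_eq_lFunction_smul D₀ hp)

/-- **C2 side: at `4 ∣ N`, `Λ₁(f) ≠ Λ₀(f)` forces `W₀` to be EISENSTEIN mod `2`** — `2 ∣ a_p(W₀) − p − 1`, i.e. `a_p(W₀)` is EVEN, for every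
prime `p ∤ N`.  Unconditional; does not prove C2. [cite: LingOesterle1991, Thm. 6] [cite: Stevens1989, §2] -/
theorem two_dvd_lFunction_sub_of_periodLatticeGamma1_ne (h4 : 2 ^ 2 ∣ N)
    (hne : periodLatticeGamma1 D₀.f ≠ periodLattice D₀.f) {p : ℕ} (hp : p.Prime) (hpN : ¬ p ∣ N) :
    (2 : ℤ) ∣ W₀.LFunction p - p - 1 := by
  haveI : NeZero p := ⟨hp.ne_zero⟩
  have h2Λ : ∀ v ∈ periodLattice D₀.f, ((2 : ℕ) : ℂ) * v ∈ periodLatticeGamma1 D₀.f := fun v hv ↦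
    pMulLatticeLeGamma1OfTracelessPrime_holds N D₀.f D₀.isNewformOf.1 2 Nat.prime_two
      ((dvd_pow_self 2 two_ne_zero).trans h4) (D₀.isNewformOf.1.cuspCoeff_eq_zero_of_sq_dvd Nat.prime_two h4) v hv
  exact_mod_cast dvd_sub_of_periodLatticeGamma1_ne D₀.f Nat.prime_two h2Λ hne hp hpN (heckeT_eq_lFunction_smul D₀ hp)

end Data

end Summit.BirchSwinnertonDyer.BirchSwinnertonDyer.Theorems.ManinLocalTwoThree

end
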